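import Summits.HodgeConjecture.HodgeConjecture.Theses.CurveNetMordellWeil

/-!
# Route CurveNetMordellWeil — `Assembly` (item stmt-HodgeConjecture-10706)

The assembly item of route `route-HodgeConjecture-CurveNetMordellWeil` (rev 3) is the implication

`LefschetzOneOne → HodgeModels → ComplexOrientationExists → CurveNetExists → DeligneDescent →
GysinPreservesAlgebraic → VerticalSupportAboveMiddle → VerticalSupportMiddle →
VerticalSupportBelowMiddle → HodgeConjecture`,

literally the type of the route's deciding theorem
`Summit.HodgeConjecture.HodgeConjecture.Theses.CurveNetMordellWeil.closes`.  The proof below is the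
same argument, recorded against the item's own decl and kept self-contained (it does not refer to
`closes`), so it does not depend on the regeneration of the route file.

The argument (pure logic + arithmetic on the codimension).  Fix an orientation family `μ` with
Poincaré duality (`ComplexOrientationExists`).  By strong induction on `q` one proves, for every
smooth projective `X` of every dimension `n`,
`span ℂ {rational (q,q)-classes in H^{2q}(X(ℂ);ℂ)} ≤ algebraicClasses X q`:

* `q = 0`: `algebraicClasses_zero` (`N⁰H⁰ = ⊤`); `q = 1`: `LefschetzOneOne`;
* `q ≥ 2`, `n ≤ 1`: `H^{2q}(X(ℂ);ℂ) = 0` (`subsingleton_complexBetti`, `2q > 2n`);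
* `q ≥ 2`, `n ≥ 2`: take the curve net `σ : X' → X`, `pr : X' → ℙ^{n-1}` of `CurveNetExists`.  A
  rational `(q,q)`-class on `X'` vanishing off `pr⁻¹(T)`, `T ⊊ ℙ^{n-1}` closed, is by `DeligneDescent`
  in the span of Gysin images `g_*(β)` of rational `(d,d)`-classes on smooth projective `W` of
  dimension `m`, `d + e = q`, `e ≥ 1`, `m + e = n`; `β` is algebraic by the induction hypothesis
  (`d < q`) and `g_*` preserves algebraic classes with the right shift (`GysinPreservesAlgebraic`).
  The regime split `lt_trichotomy (2q) n` and the three vertical-support items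
  (`VerticalSupportBelowMiddle` / `VerticalSupportMiddle` / `VerticalSupportAboveMiddle`) put every
  rational `(q,q)`-class on `X'` in `algebraicClasses X' q ⊔ span{vertical ones}`, hence in
  `algebraicClasses X' q`; finally `σ_*` (`GysinPreservesAlgebraic` with `e = 0`) carries the
  inclusion down to `X` through the comparison of `CurveNetExists`.

Then `HodgeConjectureFor n X = ⟨HodgeModels hX, cycle part⟩`.
-/

-- `Summit.HodgeConjecture.HodgeConjecture.Theorems` is the mandated namespace (single-conjunct summit:
-- Sub = Summit), which `linter.dupNamespace` flags on every declaration; the lakefile turns the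
-- linter off tree-wide (weak option), restated here so stand-alone elaboration is warning-free too.
set_option linter.dupNamespace false

namespace Summit.HodgeConjecture.HodgeConjecture.Theorems

open Summit.HodgeConjecture.HodgeConjecture.Theses.CurveNetMordellWeil
open Literature.AlgebraicGeometry.HodgeTheory Literature.AlgebraicGeometry.Motives

/-- The induction engine of the assembly, isolated: given an orientation family `μ` with Poincaré
duality, Lefschetz `(1,1)`, curve nets, Deligne descent, Gysin-preserves-algebraic and the three
vertical-support statements, the `ℂ`-span of the rational `(q,q)`-classes of every smooth projective
`X` of dimension `n` lies in `algebraicClasses X q`, for all `q` and `n` (strong induction on `q`;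
see the module docstring for the case split). -/
theorem curveNetMordellWeil_span_hodge_le_algebraic
    (μ : OrientationFamily) (hμ : μ.HasPoincareDuality)
    (hL11 : LefschetzOneOne) (hNet : CurveNetExists) (hDesc : DeligneDescent)
    (hGys : GysinPreservesAlgebraic) (hAbove : VerticalSupportAboveMiddle)
    (hMid : VerticalSupportMiddle) (hBelow : VerticalSupportBelowMiddle)
    (q : ℕ) : ∀ ⦃n : ℕ⦄ ⦃X : SchemeOver ℂ⦄, IsSmoothProjective n X →
    Submodule.span ℂ {c : complexBetti X (2 * q) | IsRationalClass c ∧ IsOfHodgeType n X (2 * q) q q c}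
      ≤ algebraicClasses X q := by
  induction q using Nat.strong_induction_on with
  | _ q ih =>
  intro n X hX
  rcases Nat.lt_or_ge q 2 with hq | hq
  · -- q = 0: everything is algebraic; q = 1: Lefschetz (1,1)
    interval_cases q
    · rw [algebraicClasses_zero]
      exact le_top
    · exact Submodule.span_le.2 fun c hc => hL11 hX c hc.1 hc.2
  rcases Nat.lt_or_ge n 2 with hn | hn
  · -- curves and points: `H^{2q} = 0` for `q ≥ 2`
    haveI := subsingleton_complexBetti hX (k := 2 * q) (by omega)
    intro c _
    rw [Subsingleton.elim c 0]
    exact Submodule.zero_mem _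
  -- the curve net `σ : X' → X`, `pr : X' → ℙ^{n-1}`
  obtain ⟨X', hX', σ, pr, hsurj, hle⟩ := hNet μ hμ hX hn (show n - 1 + 1 = n by omega)
  -- vertical Hodge classes on the total space of the curve net are algebraic (descent + IH)
  have vert : ∀ c : complexBetti X' (2 * q), IsRationalClass c → IsOfHodgeType n X' (2 * q) q q c →
      ∀ T : Set (projectiveSpace (n - 1) ℂ).left, IsClosed T → T ≠ Set.univ →
      complexBetti.restrictCompl X' (pr.left.base ⁻¹' T) (2 * q) c = 0 →
      c ∈ algebraicClasses X' q := by
    intro c hc hh T hT hTne hcT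
    have hY : IsClosed (pr.left.base ⁻¹' T) := hT.preimage pr.left.base.hom.continuous
    have hYne : pr.left.base ⁻¹' T ≠ Set.univ := by
      intro hU
      apply hTne
      refine Set.eq_univ_of_forall fun t => ?_
      obtain ⟨x, rfl⟩ := hsurj t
      have hx : x ∈ pr.left.base ⁻¹' T := by
        rw [hU]
        exact Set.mem_univ x
      exact hx
    have hmem := hDesc μ hμ hX' (pr.left.base ⁻¹' T) hY hYne c hc hh hcT
    have aux : ∀ S : Submodule ℂ (complexBetti X' (2 * q)),
        c ∈ S → S ≤ algebraicClasses X' q → c ∈ algebraicClasses X' q :=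
      fun S h₁ h₂ => h₂ h₁
    refine aux _ hmem ?_
    refine iSup_le fun d => iSup_le fun e => iSup_le fun hde => iSup_le fun he =>
      iSup_le fun W => iSup_le fun m' => iSup_le fun hm => iSup_le fun hW => iSup_le fun g => ?_
    subst hde
    exact (Submodule.map_mono (ih d (by omega) hW)).trans (hGys μ hμ hW hX' g hm)
  -- every Hodge class on X' is algebraic: regime split by the three vertical-support items
  have step : Submodule.span ℂ
      {c : complexBetti X' (2 * q) | IsRationalClass c ∧ IsOfHodgeType n X' (2 * q) q q c} ≤
      algebraicClasses X' q := by
    rcases lt_trichotomy (2 * q) n with h | h | h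
    · refine (hBelow pr hX' hq h (by omega) hsurj).trans (sup_le le_rfl (Submodule.span_le.2 ?_))
      rintro c ⟨hc, hh, T, hT, hTne, hcT⟩
      exact vert c hc hh T hT hTne hcT
    · subst h
      refine (hMid pr hX' hq (by omega) hsurj).trans (sup_le le_rfl (Submodule.span_le.2 ?_))
      rintro c ⟨hc, hh, T, hT, hTne, hcT⟩
      exact vert c hc hh T hT hTne hcT
    · refine (hAbove pr hX' hq h (by omega) hsurj).trans (sup_le le_rfl (Submodule.span_le.2 ?_))
      rintro c ⟨hc, hh, T, hT, hTne, hcT⟩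
      exact vert c hc hh T hT hTne hcT
  -- push down to X along σ (Gysin with e = 0)
  exact (hle q).trans ((Submodule.map_mono step).trans (hGys μ hμ hX' hX σ (show n + 0 = n by omega)))

/-- **Item stmt-HodgeConjecture-10706 (`Assembly`)** of route `CurveNetMordellWeil`:
`LefschetzOneOne → HodgeModels → ComplexOrientationExists → CurveNetExists → DeligneDescent →
GysinPreservesAlgebraic → VerticalSupportAboveMiddle → VerticalSupportMiddle →
VerticalSupportBelowMiddle → HodgeConjecture`.  Fix the orientation family of
`ComplexOrientationExists`; the cycle part of `HodgeConjectureFor n X` is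
`curveNetMordellWeil_span_hodge_le_algebraic` applied to the generator `c`, and the anti-vacuity
conjunct (a Hodge model) is `HodgeModels hX`.  The type is literally the route decl
`Summit.HodgeConjecture.HodgeConjecture.Theses.CurveNetMordellWeil.Assembly` (= the type of the
route's deciding theorem `closes`). -/
theorem curveNetMordellWeil_assembly_proof :
    Summit.HodgeConjecture.HodgeConjecture.Theses.CurveNetMordellWeil.Assembly := by
  unfold Summit.HodgeConjecture.HodgeConjecture.Theses.CurveNetMordellWeil.Assembly
  intro hL11 hModel hOr hNet hDesc hGys hAbove hMid hBelow n X hX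
  obtain ⟨μ, hμ⟩ := hOr
  exact ⟨hModel hX, fun p c hc hh =>
    curveNetMordellWeil_span_hodge_le_algebraic μ hμ hL11 hNet hDesc hGys hAbove hMid hBelow p hX
      (Submodule.subset_span ⟨hc, hh⟩)⟩

end Summit.HodgeConjecture.HodgeConjecture.Theorems
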